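import Literature.AlgebraicGeometry.Frobenioids.FrTrIsFrobenioid
import HarnessLib

/-!
# Frobenioids I, Theorem 5.1 (iii) from Theorem 5.1 (i): the "In particular" clauses
# (abc-iut cell, layer L1, node D-η-3)

Mochizuki, *The geometry of Frobenioids I: the general theory*, Kyushu J. Math. **62** (2008)
293–400, §5, Theorem 5.1 (iii), proof p. 99 [cite: MochizukiFrdI2008, Thm. 5.1 (iii) p.99]:

> "First, let us observe that by assertion (i), any isomorphism `α_D : A′_D ⥲ A_D` determines an
> object `(A′, α) ∈ Ob(C ×_D D^isom_{A_D})` which [in light of the fact that `A′` is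
> Frobenius-trivial, hence admits base-identity endomorphisms of Frobenius type of arbitrary
> prescribed Frobenius degree] corresponds [via the bijection of assertion (i)] to an element
> `ξ ∈ Pic_Φ(A)` such that `d · ξ = ξ`, for all `d ∈ N_{≥1}`. Thus, taking `d = 2` implies that
> `ξ = 0`, i.e., [cf. the definition of `Pic_C(A)`] that there exists an isomorphism `α : A′ ⥲ A`
> such that `α_D = Base(α)`. In particular, we conclude that base-isomorphic Frobenius-trivial
> objects of `C` are, in fact, isomorphic, and that all Frobenius-trivial objects of `C` are
> `Aut`-ample."

This file formalises exactly this paragraph over the named statement `Thm51i F A` of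
`DivisorialDescriptions.lean` (Thm. 5.1 (i) with `Ψ = Φ^birat`): from `∀ A, Thm51i F A` we get an
isomorphism `A′ ⥲ A` over any prescribed `α_D` (`exists_iso_of_thm51i`), hence the two "In
particular" statements `Thm51iii_iso_of_baseIso F`, `Thm51iii_frobeniusTrivial_isAutAmple F`, and,
with `FrTrIsFrobenioid.lean`, all of Thm. 5.1 (iii) from Thm. 5.1 (i). No statement of the paper
is strengthened.
-/

noncomputable section

namespace Literature.AlgebraicGeometry.Frobenioids

namespace PreFrobenioid

open CategoryTheory Opposite

universe w v v' u u'

variable {D : Type u} [Category.{v} D] {Φ : Dᵒᵖ ⥤ CommMonCat.{w}}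
  {C : Type u'} [Category.{v'} C] (F : C ⥤ ElemFrobenioid Φ)

/-- The trivial `A`-pair `(id_A, id_A)`. [cite: MochizukiFrdI2008, Thm. 5.1 (iii) p.99] -/
def APair.trivial (A : C) : APair F A :=
  ⟨A, A, 𝟙 A, 𝟙 A, isPreStep_of_isIso F (𝟙 A), isPreStep_of_isIso F (𝟙 A)⟩

/-- The class of the trivial `A`-pair in `Φ^gp(A)` is `0`. [cite: MochizukiFrdI2008, Thm. 5.1 (iii) p.99] -/
theorem APair.cls_trivial (A : C) : (APair.trivial F A).cls = 1 :=
  div_self' _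

/-- **Proof of Thm. 5.1 (iii), first step (p. 99)**: given Thm. 5.1 (i), a Frobenius-trivial `A′`
over a Frobenius-trivial `A` by `α_D : A′_D ⥲ A_D` is isomorphic to `A` by an `α` with
`Base(α) = α_D` ("taking `d = 2` implies that `ξ = 0`"). [cite: MochizukiFrdI2008, Thm. 5.1 (iii) p.99] -/
theorem exists_iso_of_thm51i (hF : IsFrobenioid F) (hiso : IsOfIsotropicType F)
    (h51 : ∀ A : C, Thm51i F A) {A A' : C} (hA : IsFrobeniusTrivial F A)
    (hA' : IsFrobeniusTrivial F A') (αD : baseObj F A' ≅ baseObj F A) :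
    ∃ κ : A' ≅ A, Base F κ.hom = αD.hom := by
  obtain ⟨hbij, hfrob⟩ := h51 A
  obtain ⟨hiff, _, hsurjC⟩ := hbij hF hiso hA
  let X : IsomOver F (baseObj F A) := ⟨A', αD⟩
  obtain ⟨p, hp⟩ := hsurjC ⟦X⟧
  -- the Frobenius endomorphism of degree 2 of `A'`
  obtain ⟨ζ, hζ⟩ := hA'
  obtain ⟨h2deg, h2base, h2ft⟩ := hζ 2
  have h2base' : Base F (End.asHom (ζ 2)) = 𝟙 _ := h2base
  haveI : IsIso (Base F (End.asHom (ζ 2))) := h2ft.2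
  have hinv : inv (Base F (End.asHom (ζ 2))) = 𝟙 _ :=
    IsIso.inv_eq_of_hom_inv_id (by rw [h2base', Category.comp_id])
  -- `(A', α_D ∘ Base(ζ 2)⁻¹) ≅ (A', α_D)` in `C ×_D D^isom_{A_D}`
  have hpush : (⟦X.pushforward (End.asHom (ζ 2)) h2ft.2⟧ : PicC F (baseObj F A)) = ⟦X⟧ := by
    apply Quotient.sound
    refine ⟨Iso.refl A', ?_⟩
    show Base F (𝟙 A') ≫ αD.hom = inv (Base F (End.asHom (ζ 2))) ≫ αD.hom
    rw [base_id, hinv]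
  -- `ξ = 2 · ξ`, hence `ξ = 0`
  have hsq := hfrob hF hiso hA X (End.asHom (ζ 2)) h2ft p p hp (hp.trans hpush.symm)
  rw [h2deg] at hsq
  have hξ : (QuotientGroup.mk p.cls : (biratSubfunctor F).Pic (baseObj F A)) = 1 := by
    have h2 : (QuotientGroup.mk p.cls : (biratSubfunctor F).Pic (baseObj F A)) ^ ((2 : ℕ+) : ℕ) =
        QuotientGroup.mk p.cls * QuotientGroup.mk p.cls := pow_two _
    rw [h2] at hsq
    exact (mul_eq_left.mp hsq.symm)
  -- the trivial `A`-pair has the same class, hence the same image in `Pic_C(A)`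
  have h0 : (QuotientGroup.mk (APair.trivial F A).cls : (biratSubfunctor F).Pic (baseObj F A)) =
      QuotientGroup.mk p.cls := by
    rw [APair.cls_trivial, hξ, QuotientGroup.mk_one]
  have hC : (⟦(APair.trivial F A).toIsomOver⟧ : PicC F (baseObj F A)) = ⟦X⟧ :=
    ((hiff _ _).1 h0).trans hp
  obtain ⟨κ, hκ⟩ := Quotient.exact hC
  -- `hκ : Base F κ.hom ≫ α_D.hom = (Base (𝟙 A))⁻¹ ≫ Base (𝟙 A)`
  let κ₀ : A ≅ A' := κ
  haveI : IsIso (Base F (𝟙 A)) := (APair.trivial F A).isPreStep_fst.2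
  have hκ' : Base F κ₀.hom ≫ αD.hom = 𝟙 (baseObj F A) := hκ.trans (IsIso.inv_hom_id (Base F (𝟙 A)))
  refine ⟨κ₀.symm, ?_⟩
  show Base F κ₀.inv = αD.hom
  have h1 : Base F κ₀.inv ≫ Base F κ₀.hom = 𝟙 _ := by rw [← base_comp, κ₀.inv_hom_id, base_id]
  calc Base F κ₀.inv = Base F κ₀.inv ≫ Base F κ₀.hom ≫ αD.hom := by rw [hκ', Category.comp_id]
    _ = αD.hom := by rw [← Category.assoc, h1, Category.id_comp]

/-- **Thm. 5.1 (iii)**, "In particular … base-isomorphic Frobenius-trivial objects of `C` are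
isomorphic", from Thm. 5.1 (i). [cite: MochizukiFrdI2008, Thm. 5.1 (iii) p.97] -/
theorem thm51iii_iso_of_baseIso_of_thm51i (h51 : ∀ A : C, Thm51i F A) : Thm51iii_iso_of_baseIso F := by
  intro hF hiso A A' hA hA' hAA'
  obtain ⟨e⟩ := hAA'
  obtain ⟨κ, _⟩ := exists_iso_of_thm51i F hF hiso h51 hA hA' e.symm
  exact ⟨κ.symm⟩

/-- **Thm. 5.1 (iii)**, "In particular … all Frobenius-trivial objects of `C` are `Aut`-ample", from
Thm. 5.1 (i). [cite: MochizukiFrdI2008, Thm. 5.1 (iii) p.97] -/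
theorem thm51iii_frobeniusTrivial_isAutAmple_of_thm51i (h51 : ∀ A : C, Thm51i F A) :
    Thm51iii_frobeniusTrivial_isAutAmple F := by
  intro hF hiso A hA t
  obtain ⟨κ, hκ⟩ := exists_iso_of_thm51i F hF hiso h51 hA hA t
  exact ⟨κ, Iso.ext hκ⟩

/-- **Thm. 5.1 (iii)** from Thm. 5.1 (i): `C^Fr-tr` is a Frobenioid. [cite: MochizukiFrdI2008, Thm. 5.1 (iii) p.97] -/
theorem thm51iii_isFrobenioid_of_thm51i (h51 : ∀ A : C, Thm51i F A) : Thm51iii_isFrobenioid F :=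
  thm51iii_isFrobenioid_of F (thm51iii_iso_of_baseIso_of_thm51i F h51)
    (thm51iii_frobeniusTrivial_isAutAmple_of_thm51i F h51)

/-- **Thm. 5.1 (iii)** from Thm. 5.1 (i): `C^Fr-tr` is of base-trivial type. [cite: MochizukiFrdI2008, Thm. 5.1 (iii) p.97] -/
theorem thm51iii_baseTrivial_of_thm51i (h51 : ∀ A : C, Thm51i F A) : Thm51iii_baseTrivial F :=
  thm51iii_baseTrivial_of F (thm51iii_iso_of_baseIso_of_thm51i F h51)

/-- **Thm. 5.1 (iii)** from Thm. 5.1 (i): `C^Fr-tr` is of `Aut`-ample type. [cite: MochizukiFrdI2008, Thm. 5.1 (iii) p.97] -/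
theorem thm51iii_autAmple_of_thm51i (h51 : ∀ A : C, Thm51i F A) : Thm51iii_autAmple F :=
  thm51iii_autAmple_of F (thm51iii_frobeniusTrivial_isAutAmple_of_thm51i F h51)

end PreFrobenioid

end Literature.AlgebraicGeometry.Frobenioids
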